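import Summits.QuantumFields.BalabanUV.T4Continuum.Support.B13Represents
import Summits.QuantumFields.BalabanUV.T4Continuum.Support.B13DomainGeometryTR
import Summits.QuantumFields.BalabanUV.T4Continuum.Support.B13InnerData
import Summits.QuantumFields.BalabanUV.T4Continuum.Support.B13StepTermSocket
import Summits.QuantumFields.BalabanUV.T4Continuum.Support.B13BaseInsDatum

/-!
# NE5 ∕ U3 — row O1-e on the CARRIERS OF RECORD: the assembled step model over Bałaban's paired torus carriers
# `B13Carriers.TwoRuns.carriers` with the term indexing and hard core OF RECORD (typer's wiring record, journal l.6369)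
# (claim table `t4/b2b-balaban-t4-ne5-p1/O1-CLAIM-TABLE-NE5-P1.md` row O1-e — «the concrete-carrier line after the O1-a ruling»)

Cell `pub-balaban`, unit `b2b-balaban-t4-ne5-formalise-leaf-09` (NE5 formalisation swarm, LEAF PROVER 09; row O1-e holder; generic
module `B13Represents` p208313 ACCEPTED 95bd70ec66db).  Summits-side new work under the LEAN PLACEMENT RULE (cell bookkeeping;
NOT a Literature module).  HONEST FRAMING: rung (B)+1 of the FINITE-VOLUME T⁴ continuum programme — NOT infinite volume, NOT a mass
gap, NOT the Clay problem, NOT a proof of NE5 (NOT PRINTED in [Balaban1987RG1]–[Balaban1989LargeFieldII]; they print ε-UNIFORM bounds,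
never η-RATES).  HONEST DEPENDENCY (cell line, verbatim): continuum YM on T⁴ ⇐ BetaPertH ∧ nine spine estimates (0/9 proved); BetaPertH
⇐ (D1) ∧ (D4) ∧ CAP+tail; G-an2-4 gates asym, D1 and NE2/3/4.

WHAT THIS FILE DOES.  `B13Represents.Assembly.step` is generic in the carriers and in the combinatorial slots.  Here the slots that the
swarm HAS typed on Bałaban's objects are FIXED to the records: carriers `C := R.carriers` for `R : B13Carriers.TwoRuns G` (row O1-a,
instance of record p207668, journal l.5868∕l.5894), index∕polymer∕label types `TermIdx R.carriers.Dom (Bnd R)` ∕ `R.carriers.Dom` ∕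
`InnerLabel R.carriers.Dom (Bnd R)` (row O1-d1, `B13StepTermLabels`∕`B13InnerData` p207773∕p208616), term indexing
`B13StepTermSocket.labelsIndexing (B13DomainGeometryTR.domainGeometry R) (b13InnerData R)` and hard core `touchInc
(B13DomainGeometryTR.domainGeometry R)` (typer's wiring record l.6369: the TR geometry p208152 is OF RECORD).  The slots NOBODY has typed
on Bałaban's objects stay NAMED PARAMETERS, bundled as `Slots R E IOp Hist`: the (2.14)-activity terms `act`, the operator-datum formats
`F` and the two runs' raw species suppliers (row O1-b's `RawSpecies`-type data), the insertion datum `D` (row O1-c's class), the margins.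
* §1 `Slots`, `assembly R S : Assembly R.carriers …`, `step R S E₀ cB` (= `(assembly R S).step (bHist E₀ cB)`), `outA`∕`outB`; the
  fields are the records (`step_Out`: `Out = out (labelsIndexing …) (touchInc …) S.act`, `rfl`);
* §2 L01∕L02∕L03 and the structure binders ON THE CARRIERS OF RECORD — one-line specialisations of `B13Represents.Assembly.*`:
  `representsB` (no hypothesis), `representsA` (under the transport reading), `inBase` (⇐ displayed B-side slice budget + quoted L06),
  uniqueness; the levelwise form of the output (`out_eq_levelwise`, leaf-02's socket) for the model of record.
Nothing is asserted about Bałaban's kernels∕potentials∕terms; no estimate is proved; `BetaPertH`, (B), (B^μ) absent; 0 sorry.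
-/

noncomputable section

open scoped BigOperators

namespace Summit.QuantumFields.BalabanUV.T4Continuum.B13StepOfRecord

open Literature.MathematicalPhysics.QuantumFieldTheory.Balaban1983to89
open Literature.MathematicalPhysics.QuantumFieldTheory.Balaban1983to89.T4OutputRate (Carriers Functional DecayBound)
open Literature.MathematicalPhysics.QuantumFieldTheory.Balaban1983to89.T4InputCauchyRateData (StepModel)
open Summit.QuantumFields.BalabanUV.T4Continuum.B13Carriers (TwoRuns)
open Summit.QuantumFields.BalabanUV.T4Continuum.B13OpDatum (Format OpDatum)
open Summit.QuantumFields.BalabanUV.T4Continuum.B13HistInsertion (InsDatum)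
open Summit.QuantumFields.BalabanUV.T4Continuum.B13StepTermLabels (TermIdx InnerLabel termLabels)
open Summit.QuantumFields.BalabanUV.T4Continuum.B13StepTermFamily (term out)
open Summit.QuantumFields.BalabanUV.T4Continuum.B13StepTermSocket (labelsIndexing touchInc)
open Summit.QuantumFields.BalabanUV.T4Continuum.B13InnerData (Bnd b13InnerData)
open Summit.QuantumFields.BalabanUV.T4Continuum.B13BaseInsDatum (SliceBudgetAt)
open Summit.QuantumFields.BalabanUV.T4Continuum.B13Represents (Assembly)

variable {G : Type} [GaugeGroup G] (R : TwoRuns G)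

/-! ## §1 The assembly on the carriers of record -/

/-- [folklore] DATA (no inequality inside): THE SLOTS NOT YET TYPED ON BAŁABAN's OBJECTS — the (2.14)-activity terms, the
operator-datum formats and the two runs' raw species suppliers (run A's on RUN-A backgrounds), the insertion datum, the margins.
NAMED PARAMETERS of the instance of record (rows O1-b∕c∕d deliver their TYPES; the identification with [II]'s objects is the
instancer's ∕ row O4-r's). -/
structure Slots (R : TwoRuns G) (E IOp Hist : Type*) [NormedAddCommGroup Hist] [NormedSpace ℂ Hist] where
  /-- the (2.14)-activity terms localized at a polymer with an inner label -/
  act : R.carriers.Dom → InnerLabel R.carriers.Dom (Bnd R) → OpDatum E → Hist → ℂ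
  /-- per-step entry formats -/
  F : ℕ → Format E
  /-- run A's raw species at a run-A background -/
  rawA : (ℕ → ℝ) → R.carriers.BgA → ℕ → E → ℂ
  /-- run B's raw species -/
  rawB : (ℕ → ℝ) → R.carriers.BgB → ℕ → E → ℂ
  /-- the insertion datum -/
  D : InsDatum R.carriers IOp Hist
  /-- operator margin -/
  rOp : ℕ → ℝ
  /-- history margin -/
  rHist : ℕ → ℝ
  rOp_pos : ∀ k, 0 < rOp k
  rHist_pos : ∀ k, 0 < rHist k

variable {R} {E IOp Hist : Type*} [NormedAddCommGroup Hist] [NormedSpace ℂ Hist] (S : Slots R E IOp Hist)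

/-- [folklore] **THE ASSEMBLY OF RECORD**: term indexing := `labelsIndexing (domainGeometry R) (b13InnerData R)`, hard core :=
`touchInc (domainGeometry R)` (both OF RECORD), the analytic slots from `S`. -/
def assembly : Assembly R.carriers E IOp Hist (TermIdx R.carriers.Dom (Bnd R)) R.carriers.Dom (InnerLabel R.carriers.Dom (Bnd R)) where
  𝒯 := labelsIndexing (B13DomainGeometryTR.domainGeometry R) (b13InnerData R)
  inc := touchInc (B13DomainGeometryTR.domainGeometry R)
  decInc := inferInstance
  act := S.act
  F := S.F
  rawA := S.rawA
  rawB := S.rawB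
  D := S.D
  rOp := S.rOp
  rHist := S.rHist
  rOp_pos := S.rOp_pos
  rHist_pos := S.rHist_pos

/-- [folklore] **THE STEP MODEL OF RECORD** at one-run level `E₀` and B-side slice constant `cB` (the radius of O1-f's budget box). -/
def step (E₀ cB : ℝ) : StepModel R.carriers (OpDatum E) Hist := (assembly S).step ((assembly S).bHist E₀ cB)

/-- [folklore] Run A's output of record (the recursion, `StepRecursion.recA`). -/
def outA (E₀ cB : ℝ) : Functional R.carriers R.carriers.BgA := (assembly S).outA ((assembly S).bHist E₀ cB)

/-- [folklore] Run B's output of record (`StepRecursion.recB`). -/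
def outB (E₀ cB : ℝ) : Functional R.carriers R.carriers.BgB := (assembly S).outB ((assembly S).bHist E₀ cB)

variable (E₀ cB : ℝ)

/-- [folklore] The output functional of the model of record IS leaf-08's `out` on the indexing and hard core OF RECORD (`rfl`). -/
theorem step_Out : (step S E₀ cB).Out =
    out (labelsIndexing (B13DomainGeometryTR.domainGeometry R) (b13InnerData R))
      (touchInc (B13DomainGeometryTR.domainGeometry R)) S.act := rfl

/-- [folklore] The operator data of record: run A read AT THE TRANSPORTED background, run B at its own (`rfl`). -/
theorem step_opA (g : ℕ → ℝ) (U : R.carriers.BgB) (k : ℕ) :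
    (step S E₀ cB).opA g U k = B13OpDatumJunctions.opOf S.F (fun g U k => S.rawA g (R.carriers.transport U) k) g U k := rfl
/-- [folklore] -/
theorem step_opB : (step S E₀ cB).opB = B13OpDatumJunctions.opOf S.F S.rawB := rfl
/-- [folklore] -/
theorem step_insA : (step S E₀ cB).insA = S.D.insA := rfl
/-- [folklore] -/
theorem step_insB : (step S E₀ cB).insB = S.D.insB := rfl

/-! ## §2 L01 ∕ L02 ∕ L03 on the carriers of record -/

/-- [folklore] **L02 on the carriers of record, hypothesis-free.** -/
theorem representsB (W : Set (ℕ → ℝ)) : (step S E₀ cB).RepresentsB (outB S E₀ cB) W := (assembly S).representsB _ W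

/-- [folklore] **L01 on the carriers of record**, under the transport reading of run A's insertion-operator data. -/
theorem representsA {W : Set (ℕ → ℝ)} (hT : (assembly S).TransportReads W) :
    (step S E₀ cB).RepresentsA (outA S E₀ cB) W :=
  (assembly S).representsA _ hT

/-- [folklore] L02 is definitional on the carriers of record: any represented run-B functional IS `outB` on the window. -/
theorem eq_outB {W : Set (ℕ → ℝ)} {EB : Functional R.carriers R.carriers.BgB} (hEB : (step S E₀ cB).RepresentsB EB W)
    {g : ℕ → ℝ} (hg : g ∈ W) (U : R.carriers.BgB) (X : R.carriers.Dom) : EB g U X = outB S E₀ cB g U X :=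
  (assembly S).eq_outB _ hEB hg U X

/-- [folklore] L01 is definitional on the carriers of record (at transported backgrounds). -/
theorem eq_outA {W : Set (ℕ → ℝ)} (hT : (assembly S).TransportReads W) {EA : Functional R.carriers R.carriers.BgA}
    (hEA : (step S E₀ cB).RepresentsA EA W) {g : ℕ → ℝ} (hg : g ∈ W) (U : R.carriers.BgB) (X : R.carriers.Dom) :
    EA g (R.carriers.transport U) X = outA S E₀ cB g (R.carriers.transport U) X :=
  (assembly S).eq_outA _ hT hEA hg U X

variable {S E₀ cB} in
/-- [folklore] **L03 on the carriers of record** from the displayed B-side slice budget, the quoted one-run level `DecayBound EB W E₀ κ`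
(leaf L06) and the signs (O1-f by name through `B13Represents.Assembly.inBase`). -/
theorem inBase {W : Set (ℕ → ℝ)} {κ : ℝ} {EB : Functional R.carriers R.carriers.BgB} (hb : (assembly S).SliceBudgetB W κ cB)
    (hdB : DecayBound EB W E₀ κ) (hE₀ : 0 ≤ E₀) (hcB : 0 ≤ cB) (hω : 0 ≤ S.D.ω) (hω1 : S.D.ω < 1) :
    (step S E₀ cB).InBase EB W :=
  Assembly.inBase hb hdB hE₀ hcB hω hω1

/-- [folklore] The B-side slice budget of the assembly of record IS O1-f part 2's `SliceBudgetAt … D.insOpB` (definitionally). -/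
theorem sliceBudgetB_iff (W : Set (ℕ → ℝ)) (κ : ℝ) :
    (assembly S).SliceBudgetB W κ cB ↔ SliceBudgetAt S.D (step S E₀ cB) W κ cB S.D.insOpB := Iff.rfl

/-- [folklore] The three run-A structure binders and the run-B blindness on the carriers of record (row O1-c by name). -/
theorem structure_binders (W : Set (ℕ → ℝ)) :
    (step S E₀ cB).InsAffine W ∧ (step S E₀ cB).InsBlind W ∧ (step S E₀ cB).InsHomog W ∧
      StepRecursion.InsBlindB (step S E₀ cB) W :=
  ⟨(assembly S).insAffine _ W, (assembly S).insBlind _ W, (assembly S).insHomog _ W, (assembly S).insBlindB _ W⟩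

/-- [folklore] **THE OUTPUT OF RECORD BY LEVELS** (leaf-02's socket `out_eq_levelwise`, instantiated): at a step-`k` domain `X`, if
the level sums of the terms' norms are summable, the model's output is `Σ' n Σ_{t ∈ termLabels k X n} term …` — (2.13) regrouped by
the number of factors, on Bałaban's carriers. -/
theorem out_eq_levelwise {k : ℕ} {X : R.carriers.Dom} (o : OpDatum E) (h : Hist)
    (hsum : Summable fun n => ∑ t ∈ termLabels (B13DomainGeometryTR.domainGeometry R) (b13InnerData R) k X n,
      ‖term (labelsIndexing (B13DomainGeometryTR.domainGeometry R) (b13InnerData R))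
        (touchInc (B13DomainGeometryTR.domainGeometry R)) S.act k ⟨n, t⟩ o h X‖) :
    (step S E₀ cB).Out k o h X =
      ∑' n, ∑ t ∈ termLabels (B13DomainGeometryTR.domainGeometry R) (b13InnerData R) k X n,
        term (labelsIndexing (B13DomainGeometryTR.domainGeometry R) (b13InnerData R))
          (touchInc (B13DomainGeometryTR.domainGeometry R)) S.act k ⟨n, t⟩ o h X :=
  B13StepTermSocket.out_eq_levelwise _ _ S.act o h hsum

end Summit.QuantumFields.BalabanUV.T4Continuum.B13StepOfRecord
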